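import Summits.AtomisticToContinuum.FouriersLaw.Theorems.BondHeatUncertaintyDefs
import Summits.AtomisticToContinuum.FouriersLaw.Theorems.BondHeatUncertaintySubdiffusiveBondHeatBathBondReductionFlowLaws

/-!
# Entropy balance (K4), helper 3: time integrals along the stationary flow

Helper file for crux `stmt-AtomisticToContinuum-9122` (`BondHeatUncertainty.LinearResponseFTUR`), line
`lebesgue-flip-duality`, stub `stub_entropyBalance`. Facts about the constructed flow
`z_s = Φ_s(x, B(ω))` of the pinned chain under `μ ⊗ W` for an initial law `μ` invariant under the
constructed kernels (`μ.bind P_s = μ`):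

* `pinnedChain_lintegral_comp_solMap_of_invariant` — the one-time law `law(z_r) = μ` at every real time
  `r` (Lebesgue-integral form);
* `pinnedChain_integrable_intervalIntegral_of_invariant` (registered sub-goal) — `∫₀ᵗ g(z_s) ds ∈ L¹`
  whenever `g ∈ L¹(μ)` (Tonelli + the one-time law: `E|∫₀ᵗ g(z_s)ds| ≤ t‖g‖_{L¹(μ)}`).

(Measurability of such time integrals, the `map` form of the one-time law and the `L¹` bounds on the
work-rate observables are in helper 4, next to their only use.)
-/

noncomputable section

namespace Summit.AtomisticToContinuum.FouriersLaw.Theorems.LinearResponseFTUR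

open MeasureTheory ProbabilityTheory Filter Topology Set
open scoped NNReal ENNReal
open Literature.MathematicalPhysics.KineticTheory
open Literature.MathematicalPhysics.KineticTheory.HeatConduction
open Literature.Probability.Process
open Summit.AtomisticToContinuum.FouriersLaw.Theorems.BondHeatUncertainty
open Summit.AtomisticToContinuum.FouriersLaw.Theorems.SubdiffusiveBondHeat

section Flow

variable {ω₂ lam β γ : ℝ} (hω : 0 < ω₂) (hl : 0 ≤ lam) (hβ : 0 ≤ β) (hγ : 0 ≤ γ) (N : ℕ) (T_L T_R : ℝ)
include hω hl hβ hγ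

/-- **One-time law (Lebesgue form) at every real time**: `E F(z_r) = ∫ F dμ` for measurable `F ≥ 0`,
`μ` invariant under the constructed kernels. [folklore] -/
theorem pinnedChain_lintegral_comp_solMap_of_invariant (μ : Measure (PhaseSpace N)) [SFinite μ]
    (hinv : ∀ s : ℝ≥0, μ.bind ((pinnedChain ω₂ lam β γ).transitionKernel N T_L T_R s) = μ)
    {F : PhaseSpace N → ℝ≥0∞} (hF : Measurable F) (r : ℝ) :
    ∫⁻ p, F ((pinnedChain ω₂ lam β γ).solMap N T_L T_R r p.1 (pairPath p.2)) ∂(μ.prod wienerPair) =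
      ∫⁻ y, F y ∂μ := by
  have hm := pinnedChain_measurable_solMap_pairPath hω hl hβ hγ N T_L T_R ((r.toNNReal : ℝ≥0) : ℝ)
  calc ∫⁻ p, F ((pinnedChain ω₂ lam β γ).solMap N T_L T_R r p.1 (pairPath p.2)) ∂(μ.prod wienerPair)
      = ∫⁻ p, F ((pinnedChain ω₂ lam β γ).solMap N T_L T_R ((r.toNNReal : ℝ≥0) : ℝ) p.1 (pairPath p.2))
          ∂(μ.prod wienerPair) := by
        refine lintegral_congr fun p => ?_
        rw [pinnedChain_solMap_eq_solMap_toNNReal N T_L T_R r]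
    _ = ∫⁻ y, F y ∂((μ.prod wienerPair).map
          (fun p => (pinnedChain ω₂ lam β γ).solMap N T_L T_R ((r.toNNReal : ℝ≥0) : ℝ) p.1 (pairPath p.2))) :=
        (lintegral_map hF hm).symm
    _ = ∫⁻ y, F y ∂μ := by
        rw [pinnedChain_map_solMap_of_invariant hω hl hβ hγ N T_L T_R μ _ (hinv _)]

end Flow

/-- **Time integrals of `L¹(μ)` observables along the stationary flow are integrable**: for the pinned
chain (`ω₂ > 0`, `lam, β, γ ≥ 0`), `μ` finite and invariant under the constructed kernels, `g ∈ L¹(μ)`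
measurable and `t ≥ 0`, `(x, ω) ↦ ∫₀ᵗ g(Φ_s(x, B(ω))) ds ∈ L¹(μ ⊗ W)` (Tonelli and the one-time law give
`E ∫₀ᵗ |g(z_s)| ds = t ∫|g| dμ < ∞`). Registered sub-goal of crux stmt-AtomisticToContinuum-9122 (stub
`stub_entropyBalance`). [folklore] -/
theorem pinnedChain_integrable_intervalIntegral_of_invariant :
    ∀ (ω₂ lam β γ : ℝ), 0 < ω₂ → 0 ≤ lam → 0 ≤ β → 0 ≤ γ → ∀ (N : ℕ) (T_L T_R : ℝ)
      (μ : Measure (PhaseSpace N)) [IsFiniteMeasure μ],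
      (∀ s : ℝ≥0, μ.bind ((pinnedChain ω₂ lam β γ).transitionKernel N T_L T_R s) = μ) →
      ∀ (g : PhaseSpace N → ℝ), Measurable g → Integrable g μ → ∀ (t : ℝ), 0 ≤ t →
      Integrable (fun p : PhaseSpace N × WienerPair =>
        ∫ s in (0 : ℝ)..t, g ((pinnedChain ω₂ lam β γ).solMap N T_L T_R s p.1 (pairPath p.2)))
        (μ.prod wienerPair) := by
  intro ω₂ lam β γ hω hl hβ hγ N T_L T_R μ _ hinv g hg hgi t ht
  haveI hLfin : IsFiniteMeasure ((volume : Measure ℝ).restrict (Ioc 0 t)) := by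
    refine ⟨?_⟩
    rw [Measure.restrict_apply_univ]
    exact measure_Ioc_lt_top
  have hZ := pinnedChain_measurable_solMap_process hω hl hβ hγ N T_L T_R
  set G : (PhaseSpace N × WienerPair) × ℝ → ℝ := fun w =>
    g ((pinnedChain ω₂ lam β γ).solMap N T_L T_R w.2 w.1.1 (pairPath w.1.2)) with hGdef
  have hGm : Measurable G := by
    have h1 : Measurable fun w : (PhaseSpace N × WienerPair) × ℝ => (w.2, w.1) :=
      measurable_snd.prodMk measurable_fst
    have h2 := hg.comp (hZ.comp h1)
    exact h2
  have hGi : Integrable G ((μ.prod wienerPair).prod ((volume : Measure ℝ).restrict (Ioc 0 t))) := by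
    refine ⟨hGm.aestronglyMeasurable, ?_⟩
    unfold HasFiniteIntegral
    calc ∫⁻ w, ‖G w‖ₑ ∂((μ.prod wienerPair).prod ((volume : Measure ℝ).restrict (Ioc 0 t)))
        = ∫⁻ s, ∫⁻ p, ‖G (p, s)‖ₑ ∂(μ.prod wienerPair) ∂((volume : Measure ℝ).restrict (Ioc 0 t)) :=
          lintegral_prod_symm _ hGm.enorm.aemeasurable
      _ = ∫⁻ _s, ∫⁻ y, ‖g y‖ₑ ∂μ ∂((volume : Measure ℝ).restrict (Ioc 0 t)) := by
          refine lintegral_congr fun s => ?_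
          exact pinnedChain_lintegral_comp_solMap_of_invariant hω hl hβ hγ N T_L T_R μ hinv hg.enorm s
      _ = (∫⁻ y, ‖g y‖ₑ ∂μ) * ((volume : Measure ℝ).restrict (Ioc 0 t)) univ := lintegral_const _
      _ < ∞ := ENNReal.mul_lt_top hgi.hasFiniteIntegral (measure_lt_top _ _)
  have h1 := hGi.integral_prod_left
  refine h1.congr (Eventually.of_forall fun p => ?_)
  simp only [hGdef]
  rw [intervalIntegral.integral_of_le ht]



end Summit.AtomisticToContinuum.FouriersLaw.Theorems.LinearResponseFTUR

end
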